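import Summits.SmoothPoincare4.SmoothPoincare4.Theorems.ConvexBisectionAcyclicBisectionRigidityStubUnfoldedSphereAux
import Literature.Analysis.Calculus.SmoothCutoff
import HarnessLib

/-!
# Stub `stub_unfoldedSphere` of line `folded-curve-branch-locus` for crux
# `ConvexBisection.AcyclicBisectionRigidity` (stmt-SmoothPoincare4-10507) — auxiliary file 2:
# the Morse perturbation `fM ε = rho 0 + ε · baseCut(rho 0) · σ` and its unique critical point

Sequel of `…StubUnfoldedSphereAux.lean`.  With the plateau cut-off `baseCut` (`= 1` on
`(-∞, 1/8]`, `= 0` on `[3/16, ∞)`, built from `Real.smoothTransition`) and the sheared squared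
norm `σ = ‖w‖² + ‖y‖²`, the perturbation `fM ε = rho 0 + ε · baseCut(rho 0) · σ` of the defining
function of the genus-`0` base satisfies, for `0 < ε` small (`5ε ≤ 1/16`, `80 ε D ≤ 1/2`, `D` a
bound of `|smoothTransition'|`):

* `fM_le_iff`: `{fM ε ≤ 1/4} = {rho 0 ≤ 1/4}` (the perturbation vanishes where `rho 0 ≥ 3/16`);
* `hasDerivAt_fM_lineV`: along the Euler field `d/dt|₀ fM ε (p + tV) = ρ_V (1 + ε baseCut' σ) + 2ε baseCut σ`;
* `eq_centre_of_isMCriticalPt`: **the only critical point of `fM ε` on `ℝ⁴` is the centre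
  `(x, y) = (−1, 0)`** — off the plateau a critical point is one of `rho 0` (impossible by
  `rho_eq_zero_of_isMCriticalPt`), on it the radial derivative is a sum of non-negative terms,
  forcing `ρ_V = 0`, `rho 0 = 0`, `baseCut = 1`, `σ = 0`; and `isMCriticalPt_fM_centre`: the centre is
  the global minimum.

Everything is proved; no named facts, no `sorry`.
-/

noncomputable section

-- the prescribed namespace `Summit.<P>.<Sub>.…` duplicates `SmoothPoincare4` (P = Sub)
set_option linter.dupNamespace false

open scoped Manifold ContDiff Topology ComplexConjugate
open Set Function Metric
open Literature.Topology.FourManifolds Literature.Topology.FourManifolds.LefschetzBase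

namespace Summit.SmoothPoincare4.SmoothPoincare4.Theorems.AcyclicBisectionRigidity.FoldedCurveBranchLocus

/-- Local notation: `𝔼 n = ℝⁿ` (model space). -/
local notation "𝔼 " n:arg => EuclideanSpace ℝ (Fin n)

/-! ### The plateau cut-off `baseCut` (`= 1` on `(-∞, 1/8]`, `= 0` on `[3/16, ∞)`) -/

/-- The plateau cut-off `baseCut s = smoothTransition (3 − 16 s)`: `1` for `s ≤ 1/8`, `0` for
`s ≥ 3/16`, values in `[0, 1]`, smooth. [folklore] -/
def baseCut (s : ℝ) : ℝ := Real.smoothTransition (3 - 16 * s)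

/-- `baseCut = 1` on `(-∞, 1/8]`. [folklore] -/
theorem baseCut_of_le {s : ℝ} (hs : s ≤ 1 / 8) : baseCut s = 1 :=
  Real.smoothTransition.one_of_one_le (by linarith)

/-- `baseCut = 0` on `[3/16, ∞)`. [folklore] -/
theorem baseCut_of_ge {s : ℝ} (hs : 3 / 16 ≤ s) : baseCut s = 0 :=
  Real.smoothTransition.zero_of_nonpos (by linarith)

/-- `0 ≤ baseCut`. [folklore] -/
theorem baseCut_nonneg (s : ℝ) : 0 ≤ baseCut s := Real.smoothTransition.nonneg _

/-- `baseCut ≤ 1`. [folklore] -/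
theorem baseCut_le_one (s : ℝ) : baseCut s ≤ 1 := Real.smoothTransition.le_one _

/-- `baseCut` is smooth. [folklore] -/
theorem contDiff_baseCut : ContDiff ℝ ∞ baseCut :=
  Real.smoothTransition.contDiff.comp (contDiff_const.sub (contDiff_const.mul contDiff_id))

/-- The derivative of `baseCut` (chain rule). [folklore] -/
theorem hasDerivAt_baseCut (s : ℝ) :
    HasDerivAt baseCut (deriv Real.smoothTransition (3 - 16 * s) * (-16)) s := by
  have h1 : HasDerivAt (fun s : ℝ => 3 - 16 * s) (-16) s := by
    simpa using ((hasDerivAt_id s).const_mul (16 : ℝ)).const_sub 3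
  have h2 : HasDerivAt Real.smoothTransition (deriv Real.smoothTransition (3 - 16 * s)) (3 - 16 * s) :=
    ((Real.smoothTransition.contDiff (n := 1)).differentiable (by simp) _).hasDerivAt
  exact h2.comp s h1

/-- `baseCut' = 0` on `[3/16, ∞)`. [folklore] -/
theorem deriv_baseCut_of_ge {s : ℝ} (hs : 3 / 16 ≤ s) : deriv baseCut s = 0 := by
  rw [(hasDerivAt_baseCut s).deriv, Literature.Analysis.Calculus.deriv_smoothTransition_of_nonpos (by linarith),
    zero_mul]

/-- `|baseCut'| ≤ 16 D` for any bound `D` of `|smoothTransition'|`. [folklore] -/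
theorem abs_deriv_baseCut_le {D : ℝ} (hD : ∀ t, |deriv Real.smoothTransition t| ≤ D) (s : ℝ) :
    |deriv baseCut s| ≤ 16 * D := by
  rw [(hasDerivAt_baseCut s).deriv, abs_mul]
  have := hD (3 - 16 * s)
  have h16 : |(-16 : ℝ)| = 16 := by norm_num
  rw [h16]
  nlinarith [abs_nonneg (deriv Real.smoothTransition (3 - 16 * s))]


/-! ### The Morse perturbation `fM ε = rho 0 + ε · baseCut(rho 0) · σ` -/

/-- `baseCut` is differentiable with derivative `deriv baseCut`. [folklore] -/
theorem hasDerivAt_baseCut' (s : ℝ) : HasDerivAt baseCut (deriv baseCut s) s :=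
  (contDiff_baseCut.differentiable (by simp) s).hasDerivAt

/-- **The Morse perturbation of the defining function of the base**:
`fM ε = rho 0 + ε · baseCut(rho 0) · σ`. [folklore] -/
def fM (ε : ℝ) (p : 𝔼 4) : ℝ := rho 0 p + ε * (baseCut (rho 0 p) * sigma p)

/-- `fM ε` is smooth. [folklore] -/
theorem contDiff_fM (ε : ℝ) : ContDiff ℝ ∞ (fM ε) :=
  (contDiff_rho 0).add (contDiff_const.mul ((contDiff_baseCut.comp (contDiff_rho 0)).mul contDiff_sigma))

/-- `fM ε ≥ rho 0` for `ε ≥ 0`. [folklore] -/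
theorem rho_le_fM {ε : ℝ} (hε : 0 ≤ ε) (p : 𝔼 4) : rho 0 p ≤ fM ε p := by
  unfold fM
  have : 0 ≤ baseCut (rho 0 p) * sigma p := mul_nonneg (baseCut_nonneg _) (sigma_nonneg _)
  nlinarith

/-- `fM ε ≥ 0` for `ε ≥ 0`. [folklore] -/
theorem fM_nonneg {ε : ℝ} (hε : 0 ≤ ε) (p : 𝔼 4) : 0 ≤ fM ε p :=
  (rho_nonneg 0 p).trans (rho_le_fM hε p)

/-- Off the plateau `{rho 0 < 3/16}` the perturbation vanishes: `fM ε = rho 0`. [folklore] -/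
theorem fM_eq_rho_of_ge (ε : ℝ) {p : 𝔼 4} (hp : 3 / 16 ≤ rho 0 p) : fM ε p = rho 0 p := by
  simp [fM, baseCut_of_ge hp]

/-- **`V`-derivative of the perturbation**:
`d/dt|₀ fM ε (p + t V) = ρ_V + ε (baseCut'(ρ) ρ_V σ + 2 baseCut(ρ) σ)`. [folklore] -/
theorem hasDerivAt_fM_lineV (ε : ℝ) (p : 𝔼 4) :
    HasDerivAt (fun t => fM ε (lineV p t))
      (rhoV p + ε * (deriv baseCut (rho 0 p) * rhoV p * sigma p + baseCut (rho 0 p) * (2 * sigma p))) 0 := by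
  have hρ := hasDerivAt_rho_lineV p
  have hσ := hasDerivAt_sigma_lineV p
  have hout : HasDerivAt baseCut (deriv baseCut (rho 0 (lineV p 0))) (rho 0 (lineV p 0)) := hasDerivAt_baseCut' _
  have hc := hout.comp 0 hρ
  have hcσ := hc.mul hσ
  have h := hρ.add (hcσ.const_mul ε)
  simp only [lineV_zero, Function.comp_apply] at h
  refine h.congr_deriv ?_
  ring

/-- **Off the plateau the perturbation has the derivative of `rho 0`** (`baseCut = baseCut' = 0` on
`[3/16, ∞)`). [folklore] -/
theorem hasFDerivAt_fM_of_ge (ε : ℝ) {p : 𝔼 4} (hp : 3 / 16 ≤ rho 0 p) :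
    HasFDerivAt (fM ε) (fderiv ℝ (rho 0) p) p := by
  have hρ : HasFDerivAt (rho 0) (fderiv ℝ (rho 0) p) p :=
    ((contDiff_rho 0).differentiable (by simp) p).hasFDerivAt
  have hσ : HasFDerivAt sigma (fderiv ℝ sigma p) p :=
    (contDiff_sigma.differentiable (by simp) p).hasFDerivAt
  have hc : HasFDerivAt (fun q => baseCut (rho 0 q)) (deriv baseCut (rho 0 p) • fderiv ℝ (rho 0) p) p :=
    (hasDerivAt_baseCut' (rho 0 p)).comp_hasFDerivAt p hρ
  rw [deriv_baseCut_of_ge hp, zero_smul] at hc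
  have hprod := hc.mul hσ
  rw [baseCut_of_ge hp, zero_smul, smul_zero, add_zero] at hprod
  have h := hρ.add (hprod.const_mul ε)
  rw [smul_zero, add_zero] at h
  exact h

/-! ### Bounds on the base -/

/-- On the base `‖w‖ < 2` (indeed `≤ 1/2`). [folklore] -/
theorem norm_w_lt_two {p : 𝔼 4} (hp : rho 0 p ≤ 1 / 4) : ‖w 0 p‖ < 2 := by
  have h := (bounds_of_rho_le 0 hp).2
  nlinarith [norm_nonneg (w 0 p)]

/-- On the base `σ ≤ 5` (`‖w‖² ≤ 1/4`, `‖y‖² = ‖w + x + 1‖ ≤ 1/2 + √6 + 1`). [folklore] -/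
theorem sigma_le_five {p : 𝔼 4} (hp : rho 0 p ≤ 1 / 4) : sigma p ≤ 5 := by
  obtain ⟨hx, hw⟩ := bounds_of_rho_le 0 hp
  have hwn : ‖w 0 p‖ ≤ 1 / 2 := by nlinarith [norm_nonneg (w 0 p)]
  have hxn : ‖cx p‖ ≤ 5 / 2 := by nlinarith [norm_nonneg (cx p)]
  have hy : cy p ^ 2 = w 0 p + cx p + 1 := by rw [w_zero_eq]; ring
  have hy2 : ‖cy p‖ ^ 2 ≤ 4 := by
    rw [← norm_pow, hy]
    have := norm_add₃_le (a := w 0 p) (b := cx p) (c := (1 : ℂ))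
    rw [norm_one] at this
    linarith
  unfold sigma
  linarith

/-- **The sublevel sets agree**: for `0 ≤ ε` with `5ε ≤ 1/16`, `{fM ε ≤ 1/4} = {rho 0 ≤ 1/4}`.
[folklore] -/
theorem fM_le_iff {ε : ℝ} (hε : 0 ≤ ε) (hε' : ε * 5 ≤ 1 / 16) (p : 𝔼 4) :
    fM ε p ≤ 1 / 4 ↔ rho 0 p ≤ 1 / 4 := by
  refine ⟨fun h => (rho_le_fM hε p).trans h, fun h => ?_⟩
  rcases le_or_gt (3 / 16) (rho 0 p) with h316 | h316
  · rw [fM_eq_rho_of_ge ε h316]; exact h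
  · unfold fM
    have h1 : baseCut (rho 0 p) * sigma p ≤ 5 :=
      le_trans (mul_le_of_le_one_left (sigma_nonneg p) (baseCut_le_one _)) (sigma_le_five h)
    nlinarith

/-! ### The centre and the critical points of the perturbation -/

/-- The centre `(x, y) = (−1, 0)` of the base (the point `(w, y) = (0, 0)`). [folklore] -/
def centre : 𝔼 4 := LefschetzBase.mk (-1) 0

/-- `cx centre = -1`. [folklore] -/
@[simp] theorem cx_centre : cx centre = -1 := cx_mk _ _

/-- `cy centre = 0`. [folklore] -/
@[simp] theorem cy_centre : cy centre = 0 := cy_mk _ _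

/-- `w 0 centre = 0`. [folklore] -/
@[simp] theorem w_centre : w 0 centre = 0 := by rw [w_zero_eq]; simp

/-- `rho 0 centre = 0`. [folklore] -/
@[simp] theorem rho_centre : rho 0 centre = 0 := by
  simp [rho, eta_of_le]

/-- `σ centre = 0`. [folklore] -/
@[simp] theorem sigma_centre : sigma centre = 0 := by simp [sigma]

/-- `fM ε centre = 0`. [folklore] -/
@[simp] theorem fM_centre (ε : ℝ) : fM ε centre = 0 := by simp [fM]

/-- The point with `w = 0` and `y = 0` is the centre. [folklore] -/
theorem eq_centre {p : 𝔼 4} (hw : w 0 p = 0) (hy : cy p = 0) : p = centre := by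
  have hx : cx p = -1 := by
    rw [w_zero_eq, hy] at hw
    linear_combination -hw
  rw [← mk_cx_cy p, hx, hy]
  rfl

/-- `σ = 0` only at `w = 0`, `y = 0`. [folklore] -/
theorem w_eq_zero_and_cy_eq_zero_of_sigma_eq_zero {p : 𝔼 4} (h : sigma p = 0) :
    w 0 p = 0 ∧ cy p = 0 := by
  unfold sigma at h
  have h1 : ‖w 0 p‖ ^ 2 = 0 := by nlinarith [sq_nonneg ‖w 0 p‖, sq_nonneg ‖cy p‖]
  have h2 : ‖cy p‖ ^ 2 = 0 := by nlinarith [sq_nonneg ‖w 0 p‖, sq_nonneg ‖cy p‖]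
  exact ⟨norm_eq_zero.1 (pow_eq_zero_iff two_ne_zero |>.1 h1),
    norm_eq_zero.1 (pow_eq_zero_iff two_ne_zero |>.1 h2)⟩

/-- **The centre is a critical point of `fM ε`** (`ε ≥ 0`): it is the global minimum. [folklore] -/
theorem isMCriticalPt_fM_centre {ε : ℝ} (hε : 0 ≤ ε) : IsMCriticalPt (𝓡 4) (fM ε) centre := by
  apply IsLocalMin.isMCriticalPt
  filter_upwards with q
  rw [fM_centre]
  exact fM_nonneg hε q

/-- **The centre is the only critical point of `fM ε`** for `0 < ε` with `80 ε D ≤ 1/2`, `D` a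
bound for `|smoothTransition'|`.  Off the plateau (`rho 0 ≥ 3/16`) a critical point of `fM ε` is
one of `rho 0`, where `rho 0 = 0`; on it, the radial derivative
`ρ_V (1 + ε baseCut' σ) + 2ε baseCut σ` is a sum of non-negative terms, so `ρ_V = 0`, whence `rho 0 = 0`,
`baseCut = 1`, `σ = 0`. [folklore] -/
theorem eq_centre_of_isMCriticalPt {ε D : ℝ} (hε : 0 < ε)
    (hD : ∀ t, |deriv Real.smoothTransition t| ≤ D) (hεD : ε * (16 * D) * 5 ≤ 1 / 2) {p : 𝔼 4}
    (hc : IsMCriticalPt (𝓡 4) (fM ε) p) : p = centre := by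
  by_cases hp : 3 / 16 ≤ rho 0 p
  · exfalso
    have h1 : IsMCriticalPt (𝓡 4) (rho 0) p := by
      unfold IsMCriticalPt at hc ⊢
      rw [mfderiv_eq_fderiv] at hc ⊢
      rw [← (hasFDerivAt_fM_of_ge ε hp).fderiv]
      exact hc
    have := rho_eq_zero_of_isMCriticalPt h1
    linarith
  · push Not at hp
    have hρ : rho 0 p ≤ 1 / 4 := by linarith
    have hw2 := norm_w_lt_two hρ
    have hσ := sigma_le_five hρ
    have hσ0 := sigma_nonneg p
    have hV := rhoV_nonneg hw2
    have hd : rhoV p + ε * (deriv baseCut (rho 0 p) * rhoV p * sigma p +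
        baseCut (rho 0 p) * (2 * sigma p)) = 0 := by
      by_contra hne
      exact not_isMCriticalPt_of_hasDerivAt_line ((contDiff_fM ε).differentiable (by simp))
        (hasDerivAt_fM_lineV ε p) hne hc
    have hcut' := abs_deriv_baseCut_le hD (rho 0 p)
    have hα : 1 / 2 ≤ 1 + ε * deriv baseCut (rho 0 p) * sigma p := by
      have h3 : |deriv baseCut (rho 0 p)| * sigma p ≤ 16 * D * 5 :=
        mul_le_mul hcut' hσ hσ0 (by linarith [abs_nonneg (deriv baseCut (rho 0 p))])
      have h4 : ε * (|deriv baseCut (rho 0 p)| * sigma p) ≤ 1 / 2 := by nlinarith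
      have h5 := neg_abs_le (deriv baseCut (rho 0 p))
      have h6 : 0 ≤ ε * sigma p * (deriv baseCut (rho 0 p) + |deriv baseCut (rho 0 p)|) :=
        mul_nonneg (mul_nonneg hε.le hσ0) (by linarith)
      nlinarith [h4, h6]
    have h2 : 0 ≤ baseCut (rho 0 p) * sigma p := mul_nonneg (baseCut_nonneg _) hσ0
    have hV0 : rhoV p = 0 := by nlinarith
    obtain ⟨hw0, hρ0⟩ := rho_eq_zero_of_rhoV_eq_zero hw2 hV0
    have hcut1 : baseCut (rho 0 p) = 1 := by rw [hρ0]; exact baseCut_of_le (by norm_num)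
    have hσz : sigma p = 0 := by
      rw [hV0, hcut1] at hd
      nlinarith
    exact eq_centre hw0 (w_eq_zero_and_cy_eq_zero_of_sigma_eq_zero hσz).2

/-- **Admissible parameters exist**: `0 < ε` with `5ε ≤ 1/16` and `80 ε D ≤ 1/2` for a bound
`D` of `|smoothTransition'|`. [folklore] -/
theorem exists_admissible : ∃ ε D : ℝ, 0 < ε ∧ (∀ t, |deriv Real.smoothTransition t| ≤ D) ∧
    ε * 5 ≤ 1 / 16 ∧ ε * (16 * D) * 5 ≤ 1 / 2 := by
  obtain ⟨D, hD0, hD⟩ := Literature.Analysis.Calculus.exists_bound_deriv_smoothTransition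
  refine ⟨1 / (160 * D + 80), D, ?_, hD, ?_, ?_⟩
  · positivity
  · rw [div_mul_eq_mul_div, div_le_iff₀ (by positivity)]; nlinarith
  · rw [div_mul_eq_mul_div, div_mul_eq_mul_div, div_le_iff₀ (by positivity)]; nlinarith

/-- **Registered helper `helper_exists_morsePerturbation_baseZero`** (item stmt-SmoothPoincare4-10507,
stub `stub_unfoldedSphere`, auxiliary file 2): there is a smooth perturbation `f = fM ε` of `rho 0`
with the same sublevel set `{f ≤ 1/4} = {rho 0 ≤ 1/4}` (the carrier of `Base 0`) whose only
critical point on `ℝ⁴` is the centre `(x, y) = (−1, 0)`, its global minimum. [folklore] -/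
theorem helper_exists_morsePerturbation_baseZero : ∃ f : EuclideanSpace ℝ (Fin 4) → ℝ, ContDiff ℝ ∞ f ∧ (∀ p, f p ≤ 1 / 4 ↔ Literature.Topology.FourManifolds.LefschetzBase.rho 0 p ≤ 1 / 4) ∧ (∀ p, Literature.Topology.FourManifolds.IsMCriticalPt (𝓡 4) f p ↔ p = Literature.Topology.FourManifolds.LefschetzBase.mk (-1) 0) ∧ IsMinOn f Set.univ (Literature.Topology.FourManifolds.LefschetzBase.mk (-1) 0) := by
  obtain ⟨ε, D, hε, hD, h5, hεD⟩ := exists_admissible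
  refine ⟨fM ε, contDiff_fM ε, fun p => fM_le_iff hε.le h5 p,
    fun p => ⟨fun hp => eq_centre_of_isMCriticalPt hε hD hεD hp, fun hp => ?_⟩,
    isMinOn_iff.2 fun q _ => ?_⟩
  · rw [hp]; exact isMCriticalPt_fM_centre hε.le
  · show fM ε centre ≤ fM ε q
    rw [fM_centre]
    exact fM_nonneg hε.le q

end Summit.SmoothPoincare4.SmoothPoincare4.Theorems.AcyclicBisectionRigidity.FoldedCurveBranchLocus

end
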